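/-
Copyright (c) 2026 the pub-hodgecm-mathlib formalisation cell (harness21).  Prover seat hodgecm-mathlib-K2E3-p23 (g2): Track B «K2-LIT», engine E3, line (ii′)
«H-side central germ expansion» (line lead K2E4-p06 (g2)), leaf (E) `sig_K2E3CentralGermExpansionExistence`, brick (E2) «STRATA₂», CM half at a central `z`; 2026-09-04.
-/
import Literature.NumberTheory.Rogawski1990.UnitaryTwoLocalNonsplitDictionaryCM               -- (E2) dictionary at `N = 2` (this seat): `coe_localNonsplitEquiv_two_mem`, `continuous_coe_localNonsplitEquiv_two`, `sub_one_pow_eq_zero_iff_coe_localNonsplitEquiv_two`, `…_eq_one_iff`, `isConj_iff_…`; brings ★ p855739 (E1), (W-a), (W-b)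
import Literature.NumberTheory.Automorphic.UnitaryTwoLineUnipotentClassOpenOfNorm          -- ★ p855772 (E2a) «STRATA₂» matrix half (this seat): `exists_isOpen_lineUnipotent_class_of_norm_lt`, `isClosed_setOf_coe_two_sub_one_pow_eq_zero`
import Literature.Topology.ClosedFiltrationEnumeration                                     -- ★ `Literature.Topology.exists_enum_forall_isClosed_iUnion_lt` (Bernstein–Zelevinsky closed-filtration enumeration, generic)
import HarnessLib

/-!
# «STRATA₂» on `H_v = U(Φ₂)(L⁺_v) × U(Φ₁)(L⁺_v)` at a CENTRAL `z`: the classes over `z` with unipotent `U(Φ₂)`-part form a closed stratum, each class is open inside it, and they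
# admit a CLOSED-FILTRATION ENUMERATION (Rogawski 1990 §3.9; Bernstein–Zelevinsky 1976 §1.5) — every non-split place, every residue characteristic

Topic `NumberTheory/Rogawski1990`; namespace `Literature.NumberTheory.Rogawski1990`.  THEOREMS ONLY (no definition, no instance, no notation, no named fact, no `sorry`);
kernel lane `--supports stmt-HodgeConjecture-24833`.  Cell `pub/hodgecm-mathlib` (D-0151), crux H413 = `stmt-HodgeConjecture-24833`; Track B «K2-LIT», engine E3
`K2_E3_EllipticInputs`, tier-1 unit `…Sigs_U3bCentralGerms` (ED. 3), line (ii′) «H-side central germ expansion with independent tails» (line lead K2E4-p06 (g2)), leaf **(E)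
`sig_K2E3CentralGermExpansionExistence`** (cand aea6e516723791cf: the STABLE, CENTRED Shalika germ expansion on `H_v` along the elliptic `G`-regular filter at a central `z`),
brick **(E2) «STRATA₂», CM HALF** of K2E3-p23 (g2)'s programme (E1) ★ p855739 ‹U-FIN₂› · (E2) «STRATA₂» (matrix half ★ p855772) · (E3) ‹RAO₂› · (E4) ‹DUAL₂› · (E5) PLUG.
HONEST LABEL: HC_CM is proved only modulo the 7 printed citations (2 remaining named inputs: hLiu418 = stmt-HodgeConjecture-24832, h413 = stmt-HodgeConjecture-24833) until rung 0
closes; count-neutral brick (it supplies the `hfilt` input of the ★ Howe span lemma `exists_add_mem_span_conj_sub_of_classOrbitalIntegral_eq_zero` and the strata input of the ★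
dual-pieces lemma `exists_indicator_det_classOrbitalIntegral_ne_zero_of_strata` for the classes of `H_v` over `z`).

SETTING.  `L` CM, `v` a finite place of `L⁺` with ONE place `w` of `L` above it, `H_v = U(Φ₂)(L⁺_v) × U(Φ₁)(L⁺_v)` (the tree's `cmDatum` carriers, spelled out), `z ∈ Z(H_v)`.
«`γ` lies over `z`» :≡ `((γ·z⁻¹).1 − 1)² = 0 ∧ (γ·z⁻¹).2 = 1` (leaf (E)'s unipotent-over-`z` literal VERBATIM): `γ = (u·z₁, z₂)` with `u` unipotent in `U(Φ₂)(L⁺_v)`.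
* (the one-place dictionary `ψ : U(Φ₂)(L⁺_v) → U(σ_w, J₀)(L_w)` at `N = 2` is the companion file `UnitaryTwoLocalNonsplitDictionaryCM`.)
* `H_v` AT A CENTRAL `z`: `cmDatum_local_one_mul_comm` (`U(Φ₁)(L⁺_v)` is commutative), `fst_comm_of_mem_center`, `npow_conj_sub_one_eq_zero_iff_two`,
  `centralUnipotent_conj_iff` («over `z`» is a class function), `centralUnipotent_self`; **(S1₂)** `isClosed_setOf_centralUnipotent` — the stratum is closed; **(S2₂)**
  `exists_isOpen_forall_centralUnipotent_mem_iff_isConj` — every class over `z` is cut out by an OPEN set inside its stratum `{z}` ∕ `{over z} ∖ {z}` (the regular-unipotent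
  classes `z·(n(t), 1)` by ★ p855772 at radius `|4|`, the norm step being ★ (W-b) over (W-a): every residue characteristic, every ramification); **`exists_enum_centralUnipotent_isClosed_iUnion_lt`**
  — for every finite `S` with `c ∈ S ↔ γ_c over z`, an enumeration `e : Fin n → ConjClasses H_v` of `S` with `⋃_{i<k} 𝒪(e i)` CLOSED for every `k` (★ generic
  `Literature.Topology.exists_enum_forall_isClosed_iUnion_lt`, ranks `0` (the class `{z}`) ∕ `1`).

## References
* [Rogawski1990] J. D. Rogawski, *Automorphic Representations of Unitary Groups in Three Variables*, Ann. of Math. Stud. 123 (1990): §1.9–§1.10 pp. 8–9, §3.9 p. 32 (Prop. 3.9.1),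
  §4.9 p. 54 (`H = U(2) × U(1)`), §8.1 pp. 112–113 (Howe's argument needs the closed filtration by unipotent orbits).
* [BernsteinZelevinsky1976] I. N. Bernstein, A. V. Zelevinsky, *Representations of the group GL(n, F) where F is a non-archimedean local field*, Russian Math. Surveys 31 (1976),
  §1.5 (finitely many locally closed orbits ⇒ closed filtration).
* [Serre1979] J.-P. Serre, *Local Fields*, GTM 67 (1979), Ch. V §2–§3.
* [PlatonovRapinchuk1994] V. Platonov, A. Rapinchuk, *Algebraic Groups and Number Theory* (1994), §5.1 (`U(J)(F_v) = U(σ_w, J)(E_w)` at a non-split place).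
-/

set_option autoImplicit false

noncomputable section

open scoped Matrix MatrixGroups Classical Valued
open NumberField IsDedekindDomain Matrix Set Topology

namespace Literature.NumberTheory.Rogawski1990

open Literature.NumberTheory.Automorphic Literature.NumberTheory.Automorphic.UnitaryGroup Literature.NumberTheory.GaloisRepresentations
open Literature.NumberTheory.Automorphic.HermitianLattice Literature.NumberTheory.LocalFields

/-! ## `H_v = U(Φ₂)(L⁺_v) × U(Φ₁)(L⁺_v)` at a central `z`: the stratum over `z`, its classes, and their closed enumeration -/

section Central

variable (L : Type) [Field L] [NumberField L] [IsCMField L] (v : HeightOneSpectrum (𝓞 ↥(maximalRealSubfield L)))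

/-- `U(Φ₁)(L⁺_v) ≤ GL₁(L ⊗ L⁺_v)` is commutative (one-by-one matrices over a commutative ring). [cite: Rogawski1990, §4.9 p. 54] -/
theorem cmDatum_local_one_mul_comm (a b : (cmDatum L 1 (Matrix.of fun i j : Fin 1 => if i.val + j.val + 1 = 1 then (1 : L) else 0)).Local v) : a * b = b * a := by
  apply Subtype.ext
  apply Units.ext
  show (a.val : GL (Fin 1) (UnitaryGroup.LocalRing L v)).val * (b.val : GL (Fin 1) (UnitaryGroup.LocalRing L v)).val =
    (b.val : GL (Fin 1) (UnitaryGroup.LocalRing L v)).val * (a.val : GL (Fin 1) (UnitaryGroup.LocalRing L v)).val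
  ext i j
  fin_cases i; fin_cases j
  simp only [Matrix.mul_apply, Fin.sum_univ_one, Fin.zero_eta, Fin.isValue]
  exact mul_comm _ _

variable {L v} in
/-- For `z` central in `H_v`, `z₁` commutes with every element of `U(Φ₂)(L⁺_v)` and so does `z₁⁻¹`. [cite: Rogawski1990, §4.9 p. 54] -/
theorem fst_comm_of_mem_center
    {z : (cmDatum L 2 (Matrix.of fun i j : Fin 2 => if i.val + j.val + 1 = 2 then (1 : L) else 0)).Local v × (cmDatum L 1 (Matrix.of fun i j : Fin 1 => if i.val + j.val + 1 = 1 then (1 : L) else 0)).Local v}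
    (hz : z ∈ Subgroup.center ((cmDatum L 2 (Matrix.of fun i j : Fin 2 => if i.val + j.val + 1 = 2 then (1 : L) else 0)).Local v ×
      (cmDatum L 1 (Matrix.of fun i j : Fin 1 => if i.val + j.val + 1 = 1 then (1 : L) else 0)).Local v))
    (k : (cmDatum L 2 (Matrix.of fun i j : Fin 2 => if i.val + j.val + 1 = 2 then (1 : L) else 0)).Local v) :
    k * z.1 = z.1 * k ∧ k * z.1⁻¹ = z.1⁻¹ * k := by
  have h1 : k * z.1 = z.1 * k := congrArg Prod.fst (Subgroup.mem_center_iff.1 hz (k, 1))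
  refine ⟨h1, ?_⟩
  calc k * z.1⁻¹ = z.1⁻¹ * (z.1 * k) * z.1⁻¹ := by group
    _ = z.1⁻¹ * (k * z.1) * z.1⁻¹ := by rw [h1]
    _ = z.1⁻¹ * k := by group

/-- **Conjugation preserves each condition `(g − 1)^k = 0`** in `U(Φ₂)(L⁺_v) ≤ GL₂(L ⊗ L⁺_v)` (`(x g x⁻¹ − 1)^k = x (g − 1)^k x⁻¹`; the `N = 2` twin of ★
`npow_conj_sub_one_eq_zero_iff`). [cite: Rogawski1990, §3.9 p. 32] -/
theorem npow_conj_sub_one_eq_zero_iff_two (g x : (cmDatum L 2 (Matrix.of fun i j : Fin 2 => if i.val + j.val + 1 = 2 then (1 : L) else 0)).Local v) (k : ℕ) :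
    (((x * g * x⁻¹).val : GL (Fin 2) (UnitaryGroup.LocalRing L v)).val - 1) ^ k = 0 ↔
      ((g.val : GL (Fin 2) (UnitaryGroup.LocalRing L v)).val - 1) ^ k = 0 := by
  have hval : ((x * g * x⁻¹).val : GL (Fin 2) (UnitaryGroup.LocalRing L v)) = x.val * g.val * (x.val)⁻¹ := rfl
  have hconj : (((x * g * x⁻¹).val : GL (Fin 2) (UnitaryGroup.LocalRing L v)).val - 1) =
      (x.val : GL (Fin 2) (UnitaryGroup.LocalRing L v)).val *
        (((g.val : GL (Fin 2) (UnitaryGroup.LocalRing L v)).val - 1)) * ((x.val : GL (Fin 2) (UnitaryGroup.LocalRing L v))⁻¹).val := by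
    rw [hval, Units.val_mul, Units.val_mul, mul_sub, sub_mul, mul_one, Units.mul_inv]
  rw [hconj, Units.conj_pow]
  constructor
  · intro h
    calc (((g.val : GL (Fin 2) (UnitaryGroup.LocalRing L v)).val - 1)) ^ k
        = ((x.val : GL (Fin 2) (UnitaryGroup.LocalRing L v))⁻¹).val *
            ((x.val : GL (Fin 2) (UnitaryGroup.LocalRing L v)).val *
              (((g.val : GL (Fin 2) (UnitaryGroup.LocalRing L v)).val - 1)) ^ k * ((x.val : GL (Fin 2) (UnitaryGroup.LocalRing L v))⁻¹).val) *
            (x.val : GL (Fin 2) (UnitaryGroup.LocalRing L v)).val := by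
          rw [← mul_assoc, ← mul_assoc, Units.inv_mul, one_mul, mul_assoc, Units.inv_mul, mul_one]
      _ = 0 := by rw [h, mul_zero, zero_mul]
  · intro h
    rw [h, mul_zero, zero_mul]

variable {L v} in
set_option maxHeartbeats 800000 in
-- statement-heavy carrier
/-- **«over `z`» is a class function**: for `z ∈ Z(H_v)` and `x, γ ∈ H_v`, `x γ x⁻¹` lies over `z` iff `γ` does (`z₁` central, `U(Φ₁)` commutative, unipotency is conjugation
invariant). [cite: Rogawski1990, §3.9 p. 32; §4.9 p. 54] -/
theorem centralUnipotent_conj_iff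
    {z : (cmDatum L 2 (Matrix.of fun i j : Fin 2 => if i.val + j.val + 1 = 2 then (1 : L) else 0)).Local v × (cmDatum L 1 (Matrix.of fun i j : Fin 1 => if i.val + j.val + 1 = 1 then (1 : L) else 0)).Local v}
    (hz : z ∈ Subgroup.center ((cmDatum L 2 (Matrix.of fun i j : Fin 2 => if i.val + j.val + 1 = 2 then (1 : L) else 0)).Local v ×
      (cmDatum L 1 (Matrix.of fun i j : Fin 1 => if i.val + j.val + 1 = 1 then (1 : L) else 0)).Local v))
    (γ x : (cmDatum L 2 (Matrix.of fun i j : Fin 2 => if i.val + j.val + 1 = 2 then (1 : L) else 0)).Local v × (cmDatum L 1 (Matrix.of fun i j : Fin 1 => if i.val + j.val + 1 = 1 then (1 : L) else 0)).Local v) :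
    (((((x * γ * x⁻¹ * z⁻¹).1).val : GL (Fin 2) (UnitaryGroup.LocalRing L v)).val - 1) ^ 2 = 0 ∧ (x * γ * x⁻¹ * z⁻¹).2 = 1) ↔
      (((((γ * z⁻¹).1).val : GL (Fin 2) (UnitaryGroup.LocalRing L v)).val - 1) ^ 2 = 0 ∧ (γ * z⁻¹).2 = 1) := by
  have hz' : x.1⁻¹ * z.1⁻¹ = z.1⁻¹ * x.1⁻¹ := (fst_comm_of_mem_center hz x.1⁻¹).2
  have hfst : (x * γ * x⁻¹ * z⁻¹).1 = x.1 * (γ * z⁻¹).1 * x.1⁻¹ := by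
    have e1 : (x * γ * x⁻¹ * z⁻¹).1 = x.1 * γ.1 * x.1⁻¹ * z.1⁻¹ := rfl
    have e2 : (γ * z⁻¹).1 = γ.1 * z.1⁻¹ := rfl
    rw [e1, e2]
    simp only [mul_assoc]
    rw [hz']
  have hsnd : (x * γ * x⁻¹ * z⁻¹).2 = (γ * z⁻¹).2 := by
    have e1 : (x * γ * x⁻¹ * z⁻¹).2 = x.2 * γ.2 * x.2⁻¹ * z.2⁻¹ := rfl
    have e2 : (γ * z⁻¹).2 = γ.2 * z.2⁻¹ := rfl
    rw [e1, e2, cmDatum_local_one_mul_comm L v x.2 γ.2, mul_inv_cancel_right]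
  rw [hfst, hsnd, npow_conj_sub_one_eq_zero_iff_two L v]

/-- `z` lies over itself. [cite: Rogawski1990, §3.9 p. 32] -/
theorem centralUnipotent_self
    (z : (cmDatum L 2 (Matrix.of fun i j : Fin 2 => if i.val + j.val + 1 = 2 then (1 : L) else 0)).Local v × (cmDatum L 1 (Matrix.of fun i j : Fin 1 => if i.val + j.val + 1 = 1 then (1 : L) else 0)).Local v) :
    ((((z * z⁻¹).1).val : GL (Fin 2) (UnitaryGroup.LocalRing L v)).val - 1) ^ 2 = 0 ∧ (z * z⁻¹).2 = 1 := by
  rw [mul_inv_cancel]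
  refine ⟨?_, rfl⟩
  have h : (((1 : (cmDatum L 2 (Matrix.of fun i j : Fin 2 => if i.val + j.val + 1 = 2 then (1 : L) else 0)).Local v ×
      (cmDatum L 1 (Matrix.of fun i j : Fin 1 => if i.val + j.val + 1 = 1 then (1 : L) else 0)).Local v).1).val : GL (Fin 2) (UnitaryGroup.LocalRing L v)).val = 1 := rfl
  rw [h, sub_self, zero_pow two_ne_zero]

/-- **(S1₂) THE STRATUM OVER `z` IS CLOSED** in `H_v` (continuity of the matrix coefficients and of the second projection; no centrality needed).
[cite: Rogawski1990, §3.9 p. 32] [cite: BernsteinZelevinsky1976, §1.5] -/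
theorem isClosed_setOf_centralUnipotent
    (z : (cmDatum L 2 (Matrix.of fun i j : Fin 2 => if i.val + j.val + 1 = 2 then (1 : L) else 0)).Local v × (cmDatum L 1 (Matrix.of fun i j : Fin 1 => if i.val + j.val + 1 = 1 then (1 : L) else 0)).Local v) :
    IsClosed {γ : (cmDatum L 2 (Matrix.of fun i j : Fin 2 => if i.val + j.val + 1 = 2 then (1 : L) else 0)).Local v × (cmDatum L 1 (Matrix.of fun i j : Fin 1 => if i.val + j.val + 1 = 1 then (1 : L) else 0)).Local v |
      ((((γ * z⁻¹).1).val : GL (Fin 2) (UnitaryGroup.LocalRing L v)).val - 1) ^ 2 = 0 ∧ (γ * z⁻¹).2 = 1} := by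
  have hc : Continuous fun γ : (cmDatum L 2 (Matrix.of fun i j : Fin 2 => if i.val + j.val + 1 = 2 then (1 : L) else 0)).Local v ×
      (cmDatum L 1 (Matrix.of fun i j : Fin 1 => if i.val + j.val + 1 = 1 then (1 : L) else 0)).Local v => γ * z⁻¹ := continuous_id.mul continuous_const
  refine IsClosed.inter ?_ ?_
  · have h1 : Continuous fun γ : (cmDatum L 2 (Matrix.of fun i j : Fin 2 => if i.val + j.val + 1 = 2 then (1 : L) else 0)).Local v ×
        (cmDatum L 1 (Matrix.of fun i j : Fin 1 => if i.val + j.val + 1 = 1 then (1 : L) else 0)).Local v =>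
        ((((γ * z⁻¹).1).val : GL (Fin 2) (UnitaryGroup.LocalRing L v)).val - 1) ^ 2 :=
      ((Units.continuous_val.comp (continuous_subtype_val.comp (continuous_fst.comp hc))).sub continuous_const).pow 2
    exact isClosed_eq h1 continuous_const
  · exact isClosed_eq (continuous_snd.comp hc) continuous_const

set_option maxHeartbeats 1600000 in
-- statement-heavy carrier, one-place transport
/-- **(S2₂) EVERY CLASS OVER `z` IS CUT OUT BY AN OPEN SET INSIDE ITS STRATUM** (`z ∈ Z(H_v)`, one place above `v`; every residue characteristic).  With
`SameStratum u γ :≡ (γ over z) ∧ (γ = z ↔ u = z)`: for every `u` over `z` there is an OPEN `V ⊆ H_v` with `γ ∈ V ↔ IsConj u γ` for all `γ` in the stratum of `u`.  The class `{z}`: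
`V = univ`.  A class `z·(n(t), 1)`: `V = {γ | ψ(γ₁ z₁⁻¹) ∈ V₀}` with `V₀ ⊆ GL₂(L_w)` the open set of ★ p855772 `exists_isOpen_lineUnipotent_class_of_norm_lt` at radius `|4|` — the norm
step «a `σ_w`-fixed `a` with `|a − 1| < |4|` is a norm» being ★ (W-b) `exists_fixed_norm_eq_of_valued_sub_one_lt_four` over (W-a) ★ `exists_mul_self_eq_of_valued_sub_one_lt_four_adicCompletion`
(every place) —, and `IsConj u γ` in `H_v` ⟺ `IsConj (u₁z₁⁻¹) (γ₁z₁⁻¹)` in `U(Φ₂)(L⁺_v)` (conjugate by `(d, 1)`; `z₁` central; `U(Φ₁)` untouched).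
[cite: Rogawski1990, §3.9 p. 32, Prop. 3.9.1; §4.9 p. 54] [cite: Serre1979, Ch. V §3] [cite: BernsteinZelevinsky1976, §1.5] -/
theorem exists_isOpen_forall_centralUnipotent_mem_iff_isConj (w : UnitaryGroup.PlacesOver L v) (hsub : Subsingleton (UnitaryGroup.PlacesOver L v))
    {z : (cmDatum L 2 (Matrix.of fun i j : Fin 2 => if i.val + j.val + 1 = 2 then (1 : L) else 0)).Local v × (cmDatum L 1 (Matrix.of fun i j : Fin 1 => if i.val + j.val + 1 = 1 then (1 : L) else 0)).Local v}
    (hz : z ∈ Subgroup.center ((cmDatum L 2 (Matrix.of fun i j : Fin 2 => if i.val + j.val + 1 = 2 then (1 : L) else 0)).Local v ×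
      (cmDatum L 1 (Matrix.of fun i j : Fin 1 => if i.val + j.val + 1 = 1 then (1 : L) else 0)).Local v))
    (u : (cmDatum L 2 (Matrix.of fun i j : Fin 2 => if i.val + j.val + 1 = 2 then (1 : L) else 0)).Local v × (cmDatum L 1 (Matrix.of fun i j : Fin 1 => if i.val + j.val + 1 = 1 then (1 : L) else 0)).Local v)
    (hu : ((((u * z⁻¹).1).val : GL (Fin 2) (UnitaryGroup.LocalRing L v)).val - 1) ^ 2 = 0 ∧ (u * z⁻¹).2 = 1) :
    ∃ V : Set ((cmDatum L 2 (Matrix.of fun i j : Fin 2 => if i.val + j.val + 1 = 2 then (1 : L) else 0)).Local v × (cmDatum L 1 (Matrix.of fun i j : Fin 1 => if i.val + j.val + 1 = 1 then (1 : L) else 0)).Local v),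
      IsOpen V ∧ ∀ γ : (cmDatum L 2 (Matrix.of fun i j : Fin 2 => if i.val + j.val + 1 = 2 then (1 : L) else 0)).Local v × (cmDatum L 1 (Matrix.of fun i j : Fin 1 => if i.val + j.val + 1 = 1 then (1 : L) else 0)).Local v,
        ((((((γ * z⁻¹).1).val : GL (Fin 2) (UnitaryGroup.LocalRing L v)).val - 1) ^ 2 = 0 ∧ (γ * z⁻¹).2 = 1) ∧ (γ = z ↔ u = z)) → (γ ∈ V ↔ IsConj u γ) := by
  haveI : Algebra.IsQuadraticExtension ↥(maximalRealSubfield L) L := IsCMField.isQuadraticExtension L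
  have hw : IsCMField.complexConj L • w.1 = w.1 := smul_placesOver_eq_of_subsingleton L v (IsCMField.complexConj L) hsub w
  -- reduction of `IsConj` in `H_v` over `z` to `IsConj` of the `U(Φ₂)`-parts over `z₁`
  have hred : ∀ γ : (cmDatum L 2 (Matrix.of fun i j : Fin 2 => if i.val + j.val + 1 = 2 then (1 : L) else 0)).Local v × (cmDatum L 1 (Matrix.of fun i j : Fin 1 => if i.val + j.val + 1 = 1 then (1 : L) else 0)).Local v,
      (γ * z⁻¹).2 = 1 → (IsConj u γ ↔ IsConj (u * z⁻¹).1 (γ * z⁻¹).1) := by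
    intro γ hγ2
    have hu2 : u.2 = z.2 := mul_inv_eq_one.1 hu.2
    have hγ2' : γ.2 = z.2 := mul_inv_eq_one.1 hγ2
    rw [isConj_iff, isConj_iff]
    constructor
    · rintro ⟨x, hx⟩
      refine ⟨x.1, ?_⟩
      have h1 : x.1 * u.1 * x.1⁻¹ = γ.1 := congrArg Prod.fst hx
      show x.1 * (u.1 * z.1⁻¹) * x.1⁻¹ = γ.1 * z.1⁻¹
      rw [← h1]
      simp only [mul_assoc]
      rw [(fst_comm_of_mem_center hz x.1⁻¹).2]
    · rintro ⟨d, hd⟩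
      refine ⟨(d, 1), Prod.ext ?_ ?_⟩
      · show d * u.1 * d⁻¹ = γ.1
        have hd' : d * (u.1 * z.1⁻¹) * d⁻¹ = γ.1 * z.1⁻¹ := hd
        have h1 : u.1 = u.1 * z.1⁻¹ * z.1 := by rw [inv_mul_cancel_right]
        have h2 : γ.1 = γ.1 * z.1⁻¹ * z.1 := by rw [inv_mul_cancel_right]
        rw [h1, h2, ← hd']
        calc d * (u.1 * z.1⁻¹ * z.1) * d⁻¹ = d * (u.1 * z.1⁻¹) * (z.1 * d⁻¹) := by group
          _ = d * (u.1 * z.1⁻¹) * (d⁻¹ * z.1) := by rw [(fst_comm_of_mem_center hz d⁻¹).1]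
          _ = d * (u.1 * z.1⁻¹) * d⁻¹ * z.1 := by group
      · show (1 : (cmDatum L 1 (Matrix.of fun i j : Fin 1 => if i.val + j.val + 1 = 1 then (1 : L) else 0)).Local v) * u.2 * 1⁻¹ = γ.2
        rw [one_mul, inv_one, mul_one, hu2, hγ2']
  by_cases huz : u = z
  · -- the class `{z}`: its stratum is `{z}`
    refine ⟨Set.univ, isOpen_univ, fun γ hγ => ⟨fun _ => ?_, fun _ => Set.mem_univ _⟩⟩
    rw [huz, hγ.2.2 huz]
  -- a regular-unipotent class over `z`
  have hu0 : (u * z⁻¹).1 ≠ 1 := by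
    intro h
    apply huz
    have h1 : u.1 = z.1 := by
      have h' : u.1 * z.1⁻¹ = 1 := h
      exact mul_inv_eq_one.1 h'
    exact Prod.ext h1 (mul_inv_eq_one.1 hu.2)
  -- the involution `σ_w`, its isometry, the norm step at radius `|4|`
  haveI : CharZero (w.1.adicCompletion L) := charZero_of_injective_algebraMap (algebraMap L _).injective
  have hσ : ∀ x : w.1.adicCompletion L, galAdicCompletionMap (L := L) (IsCMField.complexConj L) hw (galAdicCompletionMap (L := L) (IsCMField.complexConj L) hw x) = x :=
    galAdicCompletionMap_galAdicCompletionMap_of_smul_eq (IsCMField.complexConj L) w (IsCMField.complexConj_ne_one L) hw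
  have hvσ : ∀ a : (w.1.adicCompletion L), Valued.v ((galAdicCompletionMap (L := L) (IsCMField.complexConj L) hw) a) = Valued.v a := fun a => by
    simp only [valued_galAdicCompletionMap]
  have hsq := Literature.NumberTheory.LocalFields.exists_mul_self_eq_of_valued_sub_one_lt_four_adicCompletion L w.1
  have h4 : (4 : (w.1.adicCompletion L)) ≠ 0 := by norm_num
  have h41 : Valued.v (4 : (w.1.adicCompletion L)) ≤ 1 := by
    have h : ∀ k : ℕ, Valued.v ((k : (w.1.adicCompletion L))) ≤ 1 := fun k => by
      induction k with
      | zero => simp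
      | succ k ih =>
        rw [Nat.cast_succ]
        exact Valuation.map_add_le _ ih (by rw [Valuation.map_one])
    have h' := h 4
    rwa [Nat.cast_ofNat] at h'
  have hnorm : ∀ a : (w.1.adicCompletion L), (galAdicCompletionMap (L := L) (IsCMField.complexConj L) hw) a = a →
      Valued.v (a - 1) < Valued.v (4 : (w.1.adicCompletion L)) → ∃ r : (w.1.adicCompletion L), r ≠ 0 ∧ a = r * (galAdicCompletionMap (L := L) (IsCMField.complexConj L) hw) r := by
    intro a hfix ha
    obtain ⟨r, -, hr⟩ := exists_fixed_norm_eq_of_valued_sub_one_lt_four (galAdicCompletionMap (L := L) (IsCMField.complexConj L) hw) hvσ hsq hfix ha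
    have ha0 : a ≠ 0 := by
      intro h0
      rw [h0, zero_sub, Valuation.map_neg, Valuation.map_one] at ha
      exact lt_irrefl _ (lt_of_lt_of_le ha h41)
    refine ⟨r, fun hr0 => ha0 ?_, hr.symm⟩
    rw [← hr, hr0, zero_mul]
  -- the open set on the matrix side (★ p855772) for `ψ((u z⁻¹).1)`
  set ψ : (cmDatum L 2 (Matrix.of fun i j : Fin 2 => if i.val + j.val + 1 = 2 then (1 : L) else 0)).Local v → GL (Fin 2) (w.1.adicCompletion L) := fun y =>
    ((localNonsplitEquiv (IsCMField.complexConj L) (Matrix.of fun i j : Fin 2 => if i.val + j.val + 1 = 2 then (1 : L) else 0) (IsCMField.complexConj_ne_one L) w hw y :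
      ↥(unitaryGroupOfForm (galAdicCompletionMap (L := L) (IsCMField.complexConj L) hw) (placeForm (Matrix.of fun i j : Fin 2 => if i.val + j.val + 1 = 2 then (1 : L) else 0) w.1))) :
        GL (Fin 2) (w.1.adicCompletion L)) with hψ
  have hψsq : ∀ y : (cmDatum L 2 (Matrix.of fun i j : Fin 2 => if i.val + j.val + 1 = 2 then (1 : L) else 0)).Local v,
      ((y.val : GL (Fin 2) (UnitaryGroup.LocalRing L v)).val - 1) ^ 2 = 0 →
      ((ψ y : Matrix (Fin 2) (Fin 2) (w.1.adicCompletion L)) - 1) * ((ψ y : Matrix (Fin 2) (Fin 2) (w.1.adicCompletion L)) - 1) = 0 := fun y hy => by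
    rw [← pow_two]; exact (sub_one_pow_eq_zero_iff_coe_localNonsplitEquiv_two L w hw hsub y 2).1 hy
  have hψne : ∀ y : (cmDatum L 2 (Matrix.of fun i j : Fin 2 => if i.val + j.val + 1 = 2 then (1 : L) else 0)).Local v, y ≠ 1 → ψ y ≠ 1 :=
    fun y hy h => hy ((coe_localNonsplitEquiv_two_eq_one_iff L w hw y).1 h)
  obtain ⟨V₀, hV₀, hcls, hconv⟩ := exists_isOpen_lineUnipotent_class_of_norm_lt (galAdicCompletionMap (L := L) (IsCMField.complexConj L) hw) hσ h4 h41 hnorm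
    (coe_localNonsplitEquiv_two_mem L w hw (u * z⁻¹).1) (hψsq _ hu.1) (hψne _ hu0)
  refine ⟨(fun γ : (cmDatum L 2 (Matrix.of fun i j : Fin 2 => if i.val + j.val + 1 = 2 then (1 : L) else 0)).Local v × (cmDatum L 1 (Matrix.of fun i j : Fin 1 => if i.val + j.val + 1 = 1 then (1 : L) else 0)).Local v =>
      ψ (γ * z⁻¹).1) ⁻¹' V₀, hV₀.preimage ((continuous_coe_localNonsplitEquiv_two L w hw).comp (continuous_fst.comp (continuous_id.mul continuous_const))), fun γ hγ => ?_⟩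
  obtain ⟨⟨hγ1, hγ2⟩, hγz⟩ := hγ
  have hγ0 : (γ * z⁻¹).1 ≠ 1 := by
    intro h
    apply huz
    apply hγz.1
    have h1 : γ.1 = z.1 := by
      have h' : γ.1 * z.1⁻¹ = 1 := h
      exact mul_inv_eq_one.1 h'
    exact Prod.ext h1 (mul_inv_eq_one.1 hγ2)
  rw [hred γ hγ2, isConj_iff_exists_conj_coe_localNonsplitEquiv_two L w hw, Set.mem_preimage]
  constructor
  · intro hV
    exact hconv _ (coe_localNonsplitEquiv_two_mem L w hw (γ * z⁻¹).1) (hψsq _ hγ1) (hψne _ hγ0) hV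
  · rintro ⟨k, hk, hkc⟩
    have h := hcls k hk
    rw [hkc] at h
    exact h

set_option maxHeartbeats 1600000 in
-- a long combinatorial verification over one carrier
/-- **THE CLOSED ENUMERATION OF THE CLASSES OVER A CENTRAL `z`** (`hfilt` of the ★ Howe span lemma; every non-split place, every residue characteristic): for every finite
`S : Finset (ConjClasses H_v)` with `c ∈ S ↔ γ_c over z` there is `e : Fin n → ConjClasses H_v` enumerating `S` with `⋃_{i<k} 𝒪(e i)` CLOSED for every `k` — the filtration
`∅ ⊂ {z} ⊂ {over z}` refined class by class (★ `Literature.Topology.exists_enum_forall_isClosed_iUnion_lt` with ranks `0 ∕ 1`, strata `W 1 = {z}`, `W 2 = {over z}`; (S1₂), (S2₂)).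
[cite: Rogawski1990, §3.9 Prop. 3.9.1 p. 32; §8.1 p. 112] [cite: BernsteinZelevinsky1976, §1.5] -/
theorem exists_enum_centralUnipotent_isClosed_iUnion_lt (w : UnitaryGroup.PlacesOver L v) (hsub : Subsingleton (UnitaryGroup.PlacesOver L v))
    {z : (cmDatum L 2 (Matrix.of fun i j : Fin 2 => if i.val + j.val + 1 = 2 then (1 : L) else 0)).Local v × (cmDatum L 1 (Matrix.of fun i j : Fin 1 => if i.val + j.val + 1 = 1 then (1 : L) else 0)).Local v}
    (hz : z ∈ Subgroup.center ((cmDatum L 2 (Matrix.of fun i j : Fin 2 => if i.val + j.val + 1 = 2 then (1 : L) else 0)).Local v ×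
      (cmDatum L 1 (Matrix.of fun i j : Fin 1 => if i.val + j.val + 1 = 1 then (1 : L) else 0)).Local v))
    (S : Finset (ConjClasses ((cmDatum L 2 (Matrix.of fun i j : Fin 2 => if i.val + j.val + 1 = 2 then (1 : L) else 0)).Local v × (cmDatum L 1 (Matrix.of fun i j : Fin 1 => if i.val + j.val + 1 = 1 then (1 : L) else 0)).Local v)))
    (hS : ∀ c, c ∈ S ↔ ((((Quotient.out c * z⁻¹).1).val : GL (Fin 2) (UnitaryGroup.LocalRing L v)).val - 1) ^ 2 = 0 ∧ (Quotient.out c * z⁻¹).2 = 1) :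
    ∃ (n : ℕ) (e : Fin n → ConjClasses ((cmDatum L 2 (Matrix.of fun i j : Fin 2 => if i.val + j.val + 1 = 2 then (1 : L) else 0)).Local v × (cmDatum L 1 (Matrix.of fun i j : Fin 1 => if i.val + j.val + 1 = 1 then (1 : L) else 0)).Local v)),
      (∀ c, c ∈ S ↔ ∃ i, e i = c) ∧ ∀ k : ℕ, IsClosed (⋃ (i : Fin n) (_ : i.val < k), (e i).carrier) := by
  -- abbreviations: the predicate «over z» and its class-function property
  obtain ⟨P, hP⟩ : ∃ P : (cmDatum L 2 (Matrix.of fun i j : Fin 2 => if i.val + j.val + 1 = 2 then (1 : L) else 0)).Local v × (cmDatum L 1 (Matrix.of fun i j : Fin 1 => if i.val + j.val + 1 = 1 then (1 : L) else 0)).Local v → Prop,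
      ∀ γ, P γ ↔ (((((γ * z⁻¹).1).val : GL (Fin 2) (UnitaryGroup.LocalRing L v)).val - 1) ^ 2 = 0 ∧ (γ * z⁻¹).2 = 1) := ⟨_, fun _ => Iff.rfl⟩
  have hPconj : ∀ γ x, P (x * γ * x⁻¹) ↔ P γ := fun γ x => by rw [hP, hP]; exact centralUnipotent_conj_iff hz γ x
  have hPiso : ∀ γ γ', IsConj γ γ' → (P γ ↔ P γ') := fun γ γ' h => by
    obtain ⟨x, rfl⟩ := isConj_iff.1 h
    exact (hPconj γ x).symm
  have hPz : P z := (hP z).2 (centralUnipotent_self L v z)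
  have hout : ∀ c : ConjClasses ((cmDatum L 2 (Matrix.of fun i j : Fin 2 => if i.val + j.val + 1 = 2 then (1 : L) else 0)).Local v × (cmDatum L 1 (Matrix.of fun i j : Fin 1 => if i.val + j.val + 1 = 1 then (1 : L) else 0)).Local v),
      ConjClasses.mk (Quotient.out c) = c := fun c => Quotient.out_eq c
  have hmemA : ∀ γ (c : ConjClasses ((cmDatum L 2 (Matrix.of fun i j : Fin 2 => if i.val + j.val + 1 = 2 then (1 : L) else 0)).Local v × (cmDatum L 1 (Matrix.of fun i j : Fin 1 => if i.val + j.val + 1 = 1 then (1 : L) else 0)).Local v)),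
      γ ∈ c.carrier ↔ IsConj (Quotient.out c) γ := fun γ c => by
    constructor
    · intro h
      exact ConjClasses.mk_eq_mk_iff_isConj.1 ((hout c).trans (ConjClasses.mem_carrier_iff_mk_eq.1 h).symm)
    · intro h
      exact ConjClasses.mem_carrier_iff_mk_eq.2 ((ConjClasses.mk_eq_mk_iff_isConj.2 h).symm.trans (hout c))
  have hS' : ∀ c, c ∈ S ↔ P (Quotient.out c) := fun c => by rw [hS, hP]
  -- the class of `z` is `{z}`
  have hzconj : ∀ γ, IsConj z γ ↔ γ = z := fun γ => by
    rw [isConj_iff]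
    constructor
    · rintro ⟨x, hx⟩
      rw [← hx, Subgroup.mem_center_iff.1 hz x, mul_inv_cancel_right]
    · rintro rfl; exact ⟨1, by group⟩
  -- strata and ranks
  obtain ⟨W, hW⟩ : ∃ W : ℕ → Set ((cmDatum L 2 (Matrix.of fun i j : Fin 2 => if i.val + j.val + 1 = 2 then (1 : L) else 0)).Local v × (cmDatum L 1 (Matrix.of fun i j : Fin 1 => if i.val + j.val + 1 = 1 then (1 : L) else 0)).Local v),
      W = fun k => {γ | (0 < k ∧ γ = z) ∨ (1 < k ∧ P γ)} := ⟨_, rfl⟩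
  have hWmem : ∀ k γ, γ ∈ W k ↔ (0 < k ∧ γ = z) ∨ (1 < k ∧ P γ) := fun k γ => by rw [hW]; rfl
  obtain ⟨rk, hrk⟩ : ∃ rk : ConjClasses ((cmDatum L 2 (Matrix.of fun i j : Fin 2 => if i.val + j.val + 1 = 2 then (1 : L) else 0)).Local v × (cmDatum L 1 (Matrix.of fun i j : Fin 1 => if i.val + j.val + 1 = 1 then (1 : L) else 0)).Local v) → ℕ,
      rk = fun c => if IsConj z (Quotient.out c) then 0 else 1 := ⟨_, rfl⟩
  have hrk0 : ∀ c, IsConj z (Quotient.out c) → rk c = 0 := fun c h => by rw [hrk]; exact if_pos h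
  have hrk1 : ∀ c, ¬ IsConj z (Quotient.out c) → rk c = 1 := fun c h => by rw [hrk]; exact if_neg h
  refine Literature.Topology.exists_enum_forall_isClosed_iUnion_lt S (fun c => c.carrier) rk W ?_ ?_ ?_ ?_ ?_ ?_ ?_
  · -- W 0 = ∅
    ext γ; rw [hWmem]; simp
  · -- monotone
    intro a b hab γ h
    rw [hWmem] at h ⊢
    rcases h with ⟨ha, hγ⟩ | ⟨ha, hγ⟩
    · exact Or.inl ⟨lt_of_lt_of_le ha hab, hγ⟩
    · exact Or.inr ⟨lt_of_lt_of_le ha hab, hγ⟩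
  · -- closed strata (S1₂)
    intro k
    have hWk : W k = ({γ | 0 < k} ∩ {γ | γ = z}) ∪ ({γ | 1 < k} ∩ {γ | P γ}) := by
      ext γ; rw [hWmem]; simp only [Set.mem_union, Set.mem_inter_iff, Set.mem_setOf_eq]
    have hPcl : IsClosed {γ : (cmDatum L 2 (Matrix.of fun i j : Fin 2 => if i.val + j.val + 1 = 2 then (1 : L) else 0)).Local v × (cmDatum L 1 (Matrix.of fun i j : Fin 1 => if i.val + j.val + 1 = 1 then (1 : L) else 0)).Local v | P γ} := by
      have h := isClosed_setOf_centralUnipotent L v z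
      have heq : {γ : (cmDatum L 2 (Matrix.of fun i j : Fin 2 => if i.val + j.val + 1 = 2 then (1 : L) else 0)).Local v × (cmDatum L 1 (Matrix.of fun i j : Fin 1 => if i.val + j.val + 1 = 1 then (1 : L) else 0)).Local v | P γ} =
          {γ | ((((γ * z⁻¹).1).val : GL (Fin 2) (UnitaryGroup.LocalRing L v)).val - 1) ^ 2 = 0 ∧ (γ * z⁻¹).2 = 1} := Set.ext fun γ => hP γ
      rw [heq]; exact h
    have hconst : ∀ p : Prop, IsClosed {γ : (cmDatum L 2 (Matrix.of fun i j : Fin 2 => if i.val + j.val + 1 = 2 then (1 : L) else 0)).Local v × (cmDatum L 1 (Matrix.of fun i j : Fin 1 => if i.val + j.val + 1 = 1 then (1 : L) else 0)).Local v | p} := fun p => by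
      by_cases hp : p
      · simp only [hp, Set.setOf_true]; exact isClosed_univ
      · simp only [hp, Set.setOf_false]; exact isClosed_empty
    rw [hWk]
    exact ((hconst _).inter (isClosed_eq continuous_id continuous_const)).union ((hconst _).inter hPcl)
  · -- cells lie in their stratum
    intro c hc
    by_cases h0 : IsConj z (Quotient.out c)
    · rw [hrk0 c h0]
      have hcar : ∀ γ ∈ c.carrier, γ = z := fun γ hγ => (hzconj γ).1 (h0.trans ((hmemA γ c).1 hγ))
      refine ⟨fun γ hγ => (hWmem 1 γ).2 (Or.inl ⟨Nat.one_pos, hcar γ hγ⟩), Set.disjoint_left.2 fun γ _ h' => ?_⟩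
      rcases (hWmem 0 γ).1 h' with ⟨h, _⟩ | ⟨h, _⟩
      · exact Nat.lt_irrefl 0 h
      · exact Nat.not_lt_zero 1 h
    · rw [hrk1 c h0]
      refine ⟨fun γ hγ => (hWmem 2 γ).2 (Or.inr ⟨by norm_num, (hPiso _ _ ((hmemA γ c).1 hγ)).1 ((hS' c).1 hc)⟩), Set.disjoint_left.2 fun γ hγ h' => ?_⟩
      rcases (hWmem 1 γ).1 h' with ⟨_, hγz⟩ | ⟨h, _⟩
      · subst hγz
        exact h0 ((hmemA _ c).1 hγ).symm
      · exact absurd h (lt_irrefl 1)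
  · -- strata are covered by cells of that rank
    intro k x hx hx'
    rw [hWmem] at hx hx'
    have hx1 : ¬ (0 < k ∧ x = z) := fun h => hx' (Or.inl h)
    have hx2 : ¬ (1 < k ∧ P x) := fun h => hx' (Or.inr h)
    rcases hx with ⟨_, hxz⟩ | ⟨hk, hPx⟩
    · -- x = z, necessarily k = 0
      have hk0 : k = 0 := by
        by_contra hne
        exact hx1 ⟨Nat.pos_of_ne_zero hne, hxz⟩
      subst hk0
      rw [hxz]
      have hzz : IsConj (Quotient.out (ConjClasses.mk z)) z := (hmemA z _).1 (ConjClasses.mem_carrier_iff_mk_eq.2 rfl)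
      exact ⟨ConjClasses.mk z, (hS' _).2 ((hPiso _ _ hzz).2 hPz), hrk0 _ hzz.symm, ConjClasses.mem_carrier_iff_mk_eq.2 rfl⟩
    · -- x over z with x ≠ z and k = 1 (k ≥ 2 is impossible)
      have hk1 : k = 1 := by
        rcases Nat.lt_or_ge k 2 with h | h
        · have hk' : 1 ≤ k := by omega
          omega
        · exact absurd ⟨lt_of_lt_of_le (by norm_num) h, hPx⟩ hx2
      subst hk1
      have hxz : x ≠ z := fun h => hx1 ⟨Nat.one_pos, h⟩
      have hxx : IsConj (Quotient.out (ConjClasses.mk x)) x := (hmemA x _).1 (ConjClasses.mem_carrier_iff_mk_eq.2 rfl)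
      refine ⟨ConjClasses.mk x, (hS' _).2 ((hPiso _ _ hxx).2 hPx), hrk1 _ fun h => hxz ((hzconj x).1 (h.trans hxx)), ConjClasses.mem_carrier_iff_mk_eq.2 rfl⟩
  · -- (S2₂): cells are open in their stratum
    intro c hc
    by_cases h0 : IsConj z (Quotient.out c)
    · rw [hrk0 c h0]
      refine ⟨Set.univ, isOpen_univ, fun x hx _ => ⟨fun _ => ?_, fun _ => Set.mem_univ _⟩⟩
      rw [hWmem] at hx
      rcases hx with ⟨_, hxz⟩ | ⟨h, _⟩
      · rw [hxz]; exact (hmemA _ c).2 h0.symm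
      · exact absurd h (lt_irrefl 1)
    · rw [hrk1 c h0]
      obtain ⟨V, hVo, hV⟩ := exists_isOpen_forall_centralUnipotent_mem_iff_isConj L v w hsub hz (Quotient.out c) ((hP _).1 ((hS' c).1 hc))
      refine ⟨V, hVo, fun x hx hx' => ?_⟩
      rw [hWmem] at hx hx'
      have hx1 : ¬ (0 < 1 ∧ x = z) := fun h => hx' (Or.inl h)
      have hxz : x ≠ z := fun h => hx1 ⟨Nat.one_pos, h⟩
      have hPx : P x := by
        rcases hx with ⟨_, h⟩ | ⟨_, h⟩
        · exact absurd h hxz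
        · exact h
      have hcz : Quotient.out c ≠ z := fun h => h0 (h ▸ IsConj.refl _)
      rw [hmemA]
      exact hV x ⟨(hP x).1 hPx, ⟨fun h => absurd h hxz, fun h => absurd h hcz⟩⟩
  · -- distinct classes are disjoint
    intro c _ c' _ hcc'
    exact Set.disjoint_left.2 fun γ h h' => hcc' ((ConjClasses.mem_carrier_iff_mk_eq.1 h).symm.trans (ConjClasses.mem_carrier_iff_mk_eq.1 h'))

end Central

end Literature.NumberTheory.Rogawski1990

end
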